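import Summits.QuantumFields.YangMills.Theses.BalabanFamilyExport
import HarnessLib

/-!
# Route item `FamilySeamGlue` of `BalabanFamilyExport` (line `volume_split` on the crux `UVSeamRec`, stmt-QuantumFields-20043)

Support item stmt-QuantumFields-25261 of the draft export route `BalabanFamilyExport`:
`ThermodynamicTransfer → FiniteVolumeOddCeilings → FamilySeam` — a pure case split of the odd torus `2S+1` on its physical
size `(2S+1)·uRec β ≤ ℓ₀` (finite-volume child) or `≥ ℓ₀` (thermodynamic child); monotonicity of `(C/R⁴)ⁿ` in `C` closes
both cases.

The proof is the ideator's kernel-checked glue (ym-idea-9, `Cruxes/UVSeamRec/Lines/volume_split.lean`, `familySeam_of_split`),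
landed under `Theorems/` so that the route item is closed by name.  Bookkeeping only: no ceiling, seam, floor, E0′, NT or gap
statement is proved; YM mass gap NOT proved.
-/

set_option autoImplicit false

namespace Summit.QuantumFields.YangMills.Cruxes.UVSeamRec.ExportGlue

open Summit.QuantumFields.YangMills.Theses.BalabanFamilyExport

/-- **Route item `FamilySeamGlue` (stmt-QuantumFields-25261)**: `ThermodynamicTransfer → FiniteVolumeOddCeilings → FamilySeam`,
by the case split of the odd torus `2S+1` on its physical size `(2S+1)·uRec β ≤ ℓ₀` (finite-volume child) or `≥ ℓ₀`
(thermodynamic child), with constants `(max C₁ C₂, max β₁ β₂, min ℓ₁ ℓ₂)`. -/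
theorem familySeamGlue_proof : FamilySeamGlue := by
  intro hT hF L hLodd hL hcl
  obtain ⟨ℓ₀, hℓ₀, C₁, β₁, ℓ₁, hℓ₁, hC₁, h₁⟩ := hT L hLodd hL hcl
  obtain ⟨C₂, β₂, ℓ₂, hℓ₂, hC₂, h₂⟩ := hF ℓ₀ hℓ₀
  refine ⟨max C₁ C₂, max β₁ β₂, min ℓ₁ ℓ₂, lt_min hℓ₁ hℓ₂, le_max_of_le_left hC₁, ?_⟩
  intro β hβ S n q x R hq hR hRu hRS hsep
  have hR4 : (0 : ℝ) < (R : ℝ) ^ 4 := by positivity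
  by_cases hsz : ((2 * S + 1 : ℕ) : ℝ) * Summit.QuantumFields.YangMills.Cruxes.UVSeamRec.Transport.uRec β ≤ ℓ₀
  · have := h₂ β (le_trans (le_max_right _ _) hβ) S n q x R hq hR (le_trans hRu (min_le_right _ _)) hRS hsz hsep
    refine le_trans this (pow_le_pow_left₀ (div_nonneg hC₂ hR4.le) ?_ n)
    exact div_le_div_of_nonneg_right (le_max_right _ _) hR4.le
  · have hge : ℓ₀ ≤ ((2 * S + 1 : ℕ) : ℝ) * Summit.QuantumFields.YangMills.Cruxes.UVSeamRec.Transport.uRec β :=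
      le_of_lt (lt_of_not_ge hsz)
    have := h₁ β (le_trans (le_max_left _ _) hβ) S n q x R hq hR (le_trans hRu (min_le_left _ _)) hRS hge hsep
    refine le_trans this (pow_le_pow_left₀ (div_nonneg hC₁ hR4.le) ?_ n)
    exact div_le_div_of_nonneg_right (le_max_left _ _) hR4.le

end Summit.QuantumFields.YangMills.Cruxes.UVSeamRec.ExportGlue
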